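/-
Copyright (c) 2026. All rights reserved.
Released under Apache 2.0 license as described in the file LICENSE.
-/
import HarnessLib
import Literature.NumberTheory.LFunctions.LargeValuesAssembly

/-!
# Guth–Maynard eq. (12.1) ("FullBound") with `T` and `k` free

[topic NumberTheory/LFunctions]

Guth–Maynard, *New large value estimates for Dirichlet polynomials*, §12, proof of Proposition 3.1
(arXiv:2405.20552v2, p. 45; chunk p0026:L12–L23 of the corpus text): from Proposition 4.6 (with
`S₁` negligible), `|W| ≪ N^{2−2σ} + N^{1−2σ}(S₂ + S₃)^{1/3}`, and the bounds of Proposition 6.1 (for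
any `k ∈ ℕ`) and Proposition 11.2,

  `|W|³N^{6σ−3} ⪅ N³ + |W|²N² + TN|W|^{2−1/k} + N²|W|^{2−3/(4k)}T^{1/(2k)} + T²|W|^{3/2}`
  `        + T|W|N^{3−2σ} + T|W|²N^{3/2−σ} + T^{9/8}|W|^{29/16}N^{3/2−σ}`,

"the last inequality rearranges to give" eq. (12.1):

  `|W| ⪅ N^{2−2σ} + N^{5−6σ} + T^{k/(k+1)}N^{(4−6σ)k/(k+1)} + N^{(5−6σ)·4k/(4k+3)}T^{2/(4k+3)}`
  `      + T^{4/3}N^{2−4σ} + T^{1/2}N^{3−4σ} + TN^{9/2−7σ} + T^{18/19}N^{(72−112σ)/19}`.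

The tree's `GuthMaynardAssembly.keyProp_optimisation` (`LargeValuesAssembly.lean`) proves this
rearrangement only at `k = 4`, `T = N^{6/5}` and only in its optimised three-term form. Here we prove
the displayed eight-term inequality (12.1) itself, as an abstract real inequality with `T ≥ 1` and
`k ≥ 1` free and with an arbitrary loss factor `L ≥ 1` (in the paper `L = T^{o(1)}`), the constant
being uniform in `k`, `σ`, `T`, `N`, `L`:

* `GuthMaynardAssemblyFreeT.fullBound_of_bounds` — (12.1) from the two hypotheses above, the `S₂`
  terms written as monomials `N² T^{1/(2k)} |W|^{2−3/(4k)}`;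
* `GuthMaynardAssemblyFreeT.sq_mul_div_rpow_eq` — the identity
  `|W|²(T^{1/2}/|W|^{3/4})^{1/k} = T^{1/(2k)}|W|^{2−3/(4k)}` converting the third `S₂` term as printed
  in Proposition 6.1 into the monomial form;
* `GuthMaynardAssemblyFreeT.fullBound_of_bounds_literal` — the same with the third `S₂` term in
  the printed form `N²|W|²(T^{1/2}/|W|^{3/4})^{1/k}` (for `|W| ≥ 1`).

This is the "(12.1) with `T` and `k` free" input of the proof of Proposition 12.1 of the paper
(large values for `T^{5/6} ≤ N ≤ T`). Everything here is proved; no named fact is introduced.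

## References

* L. Guth, J. Maynard, *New large value estimates for Dirichlet polynomials*, Ann. of Math. (2) 203
  (2026); arXiv:2405.20552v2: §12, proof of Proposition 3.1, eq. (12.1) (p. 45).
-/

noncomputable section

open Real Finset

namespace Literature.NumberTheory.LFunctions

namespace GuthMaynardAssemblyFreeT

open GuthMaynardAssembly

/-- One term of the rearrangement: for `K ≥ 0`, `L, T, n ≥ 1` and `a ≤ 2`,
`(8·K·L·T^α·n^β)^{1/(3−a)} ≤ max(1, 8K)·L·T^{α/(3−a)}·n^{β/(3−a)}`.
[cite: GuthMaynard2026, Section 12, proof of Proposition 3.1 ("rearranges to give")] -/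
theorem solve_term_le {K L T n α β a : ℝ} (hK : 0 ≤ K) (hL : 1 ≤ L) (hT : 1 ≤ T) (hn : 1 ≤ n)
    (ha : a ≤ 2) :
    ((8 : ℝ) * (K * L * T ^ α * n ^ β)) ^ (1 / (3 - a)) ≤
      max 1 (8 * K) * L * (T ^ (α / (3 - a)) * n ^ (β / (3 - a))) := by
  have hL0 : 0 ≤ L := by linarith
  have hT0 : 0 ≤ T := by linarith
  have hn0 : 0 ≤ n := by linarith
  set p : ℝ := 1 / (3 - a) with hp
  have h3a : 0 < 3 - a := by linarith
  have hp0 : 0 ≤ p := by positivity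
  have hp1 : p ≤ 1 := by rw [hp, div_le_one h3a]; linarith
  have hsplit : ((8 : ℝ) * (K * L * T ^ α * n ^ β)) ^ p =
      (8 * K) ^ p * L ^ p * (T ^ α) ^ p * (n ^ β) ^ p := by
    have e1 : (8 : ℝ) * (K * L * T ^ α * n ^ β) = (8 * K) * L * T ^ α * n ^ β := by ring
    rw [e1, Real.mul_rpow (by positivity) (by positivity),
      Real.mul_rpow (by positivity) (by positivity), Real.mul_rpow (by positivity) hL0]
  have h1 : (8 * K) ^ p ≤ max 1 (8 * K) := by
    rcases le_or_gt (8 * K) 1 with hK1 | hK1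
    · exact (Real.rpow_le_one (by positivity) hK1 hp0).trans (le_max_left _ _)
    · calc (8 * K) ^ p ≤ (8 * K) ^ (1 : ℝ) := Real.rpow_le_rpow_of_exponent_le hK1.le hp1
        _ = 8 * K := Real.rpow_one _
        _ ≤ max 1 (8 * K) := le_max_right _ _
  have h2 : L ^ p ≤ L := by
    calc L ^ p ≤ L ^ (1 : ℝ) := Real.rpow_le_rpow_of_exponent_le hL hp1
      _ = L := Real.rpow_one L
  have h3 : (T ^ α) ^ p = T ^ (α / (3 - a)) := by
    rw [← Real.rpow_mul hT0, hp, mul_one_div]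
  have h4 : (n ^ β) ^ p = n ^ (β / (3 - a)) := by
    rw [← Real.rpow_mul hn0, hp, mul_one_div]
  rw [hsplit, h3, h4]
  have h5 : (8 * K) ^ p * L ^ p ≤ max 1 (8 * K) * L :=
    mul_le_mul h1 h2 (Real.rpow_nonneg hL0 _) (le_trans zero_le_one (le_max_left _ _))
  calc (8 * K) ^ p * L ^ p * T ^ (α / (3 - a)) * n ^ (β / (3 - a))
      = ((8 * K) ^ p * L ^ p) * (T ^ (α / (3 - a)) * n ^ (β / (3 - a))) := by ring
    _ ≤ (max 1 (8 * K) * L) * (T ^ (α / (3 - a)) * n ^ (β / (3 - a))) :=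
        mul_le_mul_of_nonneg_right h5 (by positivity)
    _ = _ := by ring

set_option maxHeartbeats 1600000 in
/-- **Guth–Maynard eq. (12.1) ("FullBound") with `T` and `k` free, abstract form.** Let `k ≥ 1`,
`n, T, L ≥ 1`, `X, S ≥ 0`, `σ ∈ ℝ`, with
`X ≤ C₀ (n^{2−2σ} + n^{1−2σ} S^{1/3})` (Proposition 4.6, `S₁` negligible) and
`S ≤ C₁ L (n²X² + TnX^{2−1/k} + n²T^{1/(2k)}X^{2−3/(4k)} + T²X^{3/2} + TXn^{3−2σ} + TX²n^{3/2−σ}`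
`        + T^{9/8}X^{29/16}n^{3/2−σ})` (Propositions 6.1 and 11.2 with loss factor `L`). Then
`X ≤ C L (n^{2−2σ} + n^{5−6σ} + T^{k/(k+1)}n^{(4−6σ)k/(k+1)} + n^{(5−6σ)4k/(4k+3)}T^{2/(4k+3)}`
`        + T^{4/3}n^{2−4σ} + T^{1/2}n^{3−4σ} + Tn^{9/2−7σ} + T^{18/19}n^{(72−112σ)/19})`
with `C` depending only on `C₀, C₁`: "`|W|³N^{6σ−3} ⪅ N³ + S₂ + S₃ ⪅ …` The last inequality
rearranges to give (12.1)."
[cite: GuthMaynard2026, Section 12, proof of Proposition 3.1, eq. (12.1)] -/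
theorem fullBound_of_bounds (C₀ C₁ : ℝ) (hC₀ : 0 ≤ C₀) (hC₁ : 0 ≤ C₁) :
    ∃ C, 0 ≤ C ∧ ∀ (k : ℕ) (σ n T L X S : ℝ), 1 ≤ k → 1 ≤ n → 1 ≤ T → 1 ≤ L → 0 ≤ X → 0 ≤ S →
      X ≤ C₀ * (n ^ (2 - 2 * σ) + n ^ (1 - 2 * σ) * S ^ (1 / 3 : ℝ)) →
      S ≤ C₁ * L * (n ^ 2 * X ^ 2 + T * n * X ^ (2 - 1 / (k : ℝ)) +
        n ^ 2 * T ^ (1 / (2 * (k : ℝ))) * X ^ (2 - 3 / (4 * (k : ℝ))) +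
        T ^ 2 * X ^ (3 / 2 : ℝ) + T * X * n ^ (3 - 2 * σ) + T * X ^ 2 * n ^ (3 / 2 - σ) +
        T ^ (9 / 8 : ℝ) * X ^ (29 / 16 : ℝ) * n ^ (3 / 2 - σ)) →
      X ≤ C * L * (n ^ (2 - 2 * σ) + n ^ (5 - 6 * σ) +
        T ^ ((k : ℝ) / ((k : ℝ) + 1)) * n ^ ((4 - 6 * σ) * ((k : ℝ) / ((k : ℝ) + 1))) +
        n ^ ((5 - 6 * σ) * (4 * (k : ℝ) / (4 * (k : ℝ) + 3))) * T ^ (2 / (4 * (k : ℝ) + 3)) +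
        T ^ (4 / 3 : ℝ) * n ^ (2 - 4 * σ) + T ^ (1 / 2 : ℝ) * n ^ (3 - 4 * σ) +
        T * n ^ (9 / 2 - 7 * σ) + T ^ (18 / 19 : ℝ) * n ^ ((72 - 112 * σ) / 19)) := by
  set K : ℝ := 4 * C₀ ^ 3 * (1 + C₁) with hK
  have hK0 : 0 ≤ K := by positivity
  refine ⟨max 1 (8 * K), by positivity, ?_⟩
  intro k σ n T L X S hk hn hT hL hX hS0 h0 hS
  have hn0 : 0 < n := by linarith
  have hT0 : 0 < T := by linarith
  have hL0 : 0 < L := by linarith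
  have hk0 : (0 : ℝ) < k := by exact_mod_cast hk
  have hkne : (k : ℝ) ≠ 0 := hk0.ne'
  have hk1ne : (k : ℝ) + 1 ≠ 0 := by positivity
  have hk43ne : 4 * (k : ℝ) + 3 ≠ 0 := by positivity
  -- the exponents: `A_i = K L T^{α_i} n^{β_i}`, powers `X^{a_i}`
  let α : Fin 8 → ℝ := ![0, 0, 1, 1 / (2 * (k : ℝ)), 2, 1, 1, 9 / 8]
  let β : Fin 8 → ℝ := ![6 - 6 * σ, 5 - 6 * σ, 4 - 6 * σ, 5 - 6 * σ, 3 - 6 * σ, 6 - 8 * σ,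
    9 / 2 - 7 * σ, 9 / 2 - 7 * σ]
  let a : Fin 8 → ℝ := ![0, 2, 2 - 1 / (k : ℝ), 2 - 3 / (4 * (k : ℝ)), 3 / 2, 1, 2, 29 / 16]
  have ha2 : ∀ i : Fin 8, a i ≤ 2 := by
    intro i
    (fin_cases i <;> simp only [a] <;> norm_num); positivity
  -- Step 1: cube Proposition 4.6
  have hcube : X ^ 3 ≤ 4 * C₀ ^ 3 * n ^ (6 - 6 * σ) + 4 * C₀ ^ 3 * (n ^ (3 - 6 * σ) * S) := by
    set A : ℝ := n ^ (2 - 2 * σ) with hA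
    set B : ℝ := n ^ (1 - 2 * σ) * S ^ (1 / 3 : ℝ) with hB
    have hA0 : 0 ≤ A := by positivity
    have hB0 : 0 ≤ B := by positivity
    have h1 : X ^ 3 ≤ (C₀ * (A + B)) ^ 3 := pow_le_pow_left₀ hX h0 3
    have h2 : (A + B) ^ 3 ≤ 4 * (A ^ 3 + B ^ 3) := by
      nlinarith [mul_nonneg (mul_nonneg hA0 hB0) (add_nonneg hA0 hB0), sq_nonneg (A - B),
        mul_nonneg (sq_nonneg (A - B)) (add_nonneg hA0 hB0)]
    have hA3 : A ^ 3 = n ^ (6 - 6 * σ) := by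
      rw [hA, ← Real.rpow_natCast, ← Real.rpow_mul hn0.le]; ring_nf
    have hB3 : B ^ 3 = n ^ (3 - 6 * σ) * S := by
      rw [hB, mul_pow, ← Real.rpow_natCast (n ^ (1 - 2 * σ)), ← Real.rpow_mul hn0.le,
        ← Real.rpow_natCast (S ^ (1 / 3 : ℝ)), ← Real.rpow_mul hS0]
      norm_num
      left; ring_nf
    calc X ^ 3 ≤ (C₀ * (A + B)) ^ 3 := h1
      _ = C₀ ^ 3 * (A + B) ^ 3 := by ring
      _ ≤ C₀ ^ 3 * (4 * (A ^ 3 + B ^ 3)) := by gcongr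
      _ = _ := by rw [hA3, hB3]; ring
  -- Step 2: the eight terms `K L T^{α_i} n^{β_i} X^{a_i}`
  have hpow : ∀ x y : ℝ, n ^ (x + y) = n ^ x * n ^ y := fun x y ↦ Real.rpow_add hn0 x y
  have hn2 : n ^ 2 = n ^ (2 : ℝ) := (Real.rpow_two n).symm
  have hn1 : n = n ^ (1 : ℝ) := (Real.rpow_one n).symm
  have hX2 : X ^ 2 = X ^ (2 : ℝ) := (Real.rpow_two X).symm
  have hX1 : X = X ^ (1 : ℝ) := (Real.rpow_one X).symm
  have hX0' : X ^ (0 : ℝ) = 1 := Real.rpow_zero X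
  have hT0' : T ^ (0 : ℝ) = 1 := Real.rpow_zero T
  have hT1 : T = T ^ (1 : ℝ) := (Real.rpow_one T).symm
  have hT2 : T ^ 2 = T ^ (2 : ℝ) := (Real.rpow_two T).symm
  have hc : 4 * C₀ ^ 3 * C₁ ≤ K * L := by
    have : 4 * C₀ ^ 3 * C₁ ≤ K := by rw [hK]; nlinarith [pow_nonneg hC₀ 3]
    nlinarith
  have hc' : 4 * C₀ ^ 3 ≤ K * L := by
    have : 4 * C₀ ^ 3 ≤ K := by rw [hK]; nlinarith [pow_nonneg hC₀ 3]
    nlinarith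
  -- term 0
  have P0 : 4 * C₀ ^ 3 * n ^ (6 - 6 * σ) ≤ K * L * T ^ (α 0) * n ^ (β 0) * X ^ (a 0) := by
    simp only [α, β, a, Matrix.cons_val_zero, hX0', hT0', mul_one]
    exact mul_le_mul_of_nonneg_right hc' (by positivity)
  -- the generic shape of terms 1–7
  have Pgen : ∀ (i : Fin 8) (Tm : ℝ), 0 ≤ Tm →
      n ^ (3 - 6 * σ) * Tm = T ^ (α i) * n ^ (β i) * X ^ (a i) →
      4 * C₀ ^ 3 * (n ^ (3 - 6 * σ) * (C₁ * L * Tm)) ≤ K * L * T ^ (α i) * n ^ (β i) * X ^ (a i) := by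
    intro i Tm hTm hEq
    have : 4 * C₀ ^ 3 * (n ^ (3 - 6 * σ) * (C₁ * L * Tm)) =
        (4 * C₀ ^ 3 * C₁) * L * (n ^ (3 - 6 * σ) * Tm) := by ring
    rw [this, hEq]
    have h1 : (4 * C₀ ^ 3 * C₁) * L ≤ K * L := by
      have : 4 * C₀ ^ 3 * C₁ ≤ K := by rw [hK]; nlinarith [pow_nonneg hC₀ 3]
      exact mul_le_mul_of_nonneg_right this hL0.le
    calc (4 * C₀ ^ 3 * C₁) * L * (T ^ (α i) * n ^ (β i) * X ^ (a i))
        ≤ K * L * (T ^ (α i) * n ^ (β i) * X ^ (a i)) :=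
          mul_le_mul_of_nonneg_right h1 (by positivity)
      _ = _ := by ring
  have P1 := Pgen 1 (n ^ 2 * X ^ 2) (by positivity) (by
    simp only [α, β, a, Matrix.cons_val_one, Matrix.cons_val_zero, hT0']
    rw [hn2, hX2, show 5 - 6 * σ = (3 - 6 * σ) + 2 by ring, hpow]; ring)
  have P2 := Pgen 2 (T * n * X ^ (2 - 1 / (k : ℝ))) (by positivity) (by
    simp only [α, β, a, Matrix.cons_val]
    rw [show 4 - 6 * σ = (3 - 6 * σ) + 1 by ring, hpow, ← hn1, ← hT1]; ring)
  have P3 := Pgen 3 (n ^ 2 * T ^ (1 / (2 * (k : ℝ))) * X ^ (2 - 3 / (4 * (k : ℝ))))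
    (by positivity) (by
    simp only [α, β, a, Matrix.cons_val]
    rw [hn2, show 5 - 6 * σ = (3 - 6 * σ) + 2 by ring, hpow]; ring)
  have P4 := Pgen 4 (T ^ 2 * X ^ (3 / 2 : ℝ)) (by positivity) (by
    simp only [α, β, a, Matrix.cons_val]
    rw [hT2]; ring)
  have P5 := Pgen 5 (T * X * n ^ (3 - 2 * σ)) (by positivity) (by
    simp only [α, β, a, Matrix.cons_val]
    rw [show 6 - 8 * σ = (3 - 6 * σ) + (3 - 2 * σ) by ring, hpow, ← hX1, ← hT1]; ring)
  have P6 := Pgen 6 (T * X ^ 2 * n ^ (3 / 2 - σ)) (by positivity) (by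
    simp only [α, β, a, Matrix.cons_val]
    rw [hX2, show 9 / 2 - 7 * σ = (3 - 6 * σ) + (3 / 2 - σ) by ring, hpow, ← hT1]; ring)
  have P7 := Pgen 7 (T ^ (9 / 8 : ℝ) * X ^ (29 / 16 : ℝ) * n ^ (3 / 2 - σ)) (by positivity) (by
    simp only [α, β, a, Matrix.cons_val]
    rw [show 9 / 2 - 7 * σ = (3 - 6 * σ) + (3 / 2 - σ) by ring, hpow]; ring)
  have hsum : X ^ 3 ≤ ∑ i : Fin 8, (K * L * T ^ (α i) * n ^ (β i)) * X ^ (a i) := by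
    rw [Fin.sum_univ_eight]
    have hS' : 4 * C₀ ^ 3 * (n ^ (3 - 6 * σ) * S) ≤ 4 * C₀ ^ 3 * (n ^ (3 - 6 * σ) *
        (C₁ * L * (n ^ 2 * X ^ 2 + T * n * X ^ (2 - 1 / (k : ℝ)) +
        n ^ 2 * T ^ (1 / (2 * (k : ℝ))) * X ^ (2 - 3 / (4 * (k : ℝ))) +
        T ^ 2 * X ^ (3 / 2 : ℝ) + T * X * n ^ (3 - 2 * σ) + T * X ^ 2 * n ^ (3 / 2 - σ) +
        T ^ (9 / 8 : ℝ) * X ^ (29 / 16 : ℝ) * n ^ (3 / 2 - σ)))) := by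
      gcongr
    have e : 4 * C₀ ^ 3 * (n ^ (3 - 6 * σ) *
        (C₁ * L * (n ^ 2 * X ^ 2 + T * n * X ^ (2 - 1 / (k : ℝ)) +
        n ^ 2 * T ^ (1 / (2 * (k : ℝ))) * X ^ (2 - 3 / (4 * (k : ℝ))) +
        T ^ 2 * X ^ (3 / 2 : ℝ) + T * X * n ^ (3 - 2 * σ) + T * X ^ 2 * n ^ (3 / 2 - σ) +
        T ^ (9 / 8 : ℝ) * X ^ (29 / 16 : ℝ) * n ^ (3 / 2 - σ)))) =
        4 * C₀ ^ 3 * (n ^ (3 - 6 * σ) * (C₁ * L * (n ^ 2 * X ^ 2))) +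
        4 * C₀ ^ 3 * (n ^ (3 - 6 * σ) * (C₁ * L * (T * n * X ^ (2 - 1 / (k : ℝ))))) +
        4 * C₀ ^ 3 * (n ^ (3 - 6 * σ) * (C₁ * L *
          (n ^ 2 * T ^ (1 / (2 * (k : ℝ))) * X ^ (2 - 3 / (4 * (k : ℝ)))))) +
        4 * C₀ ^ 3 * (n ^ (3 - 6 * σ) * (C₁ * L * (T ^ 2 * X ^ (3 / 2 : ℝ)))) +
        4 * C₀ ^ 3 * (n ^ (3 - 6 * σ) * (C₁ * L * (T * X * n ^ (3 - 2 * σ)))) +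
        4 * C₀ ^ 3 * (n ^ (3 - 6 * σ) * (C₁ * L * (T * X ^ 2 * n ^ (3 / 2 - σ)))) +
        4 * C₀ ^ 3 * (n ^ (3 - 6 * σ) * (C₁ * L *
          (T ^ (9 / 8 : ℝ) * X ^ (29 / 16 : ℝ) * n ^ (3 / 2 - σ)))) := by ring
    rw [e] at hS'
    linarith [hcube, hS', P0, P1, P2, P3, P4, P5, P6, P7]
  -- Step 3: solve for `X`
  have hle := le_sum_rpow_of_cube_le (Finset.univ : Finset (Fin 8))
    (fun i ↦ K * L * T ^ (α i) * n ^ (β i)) a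
    (fun i _ ↦ by positivity) (fun i _ ↦ by linarith [ha2 i]) hsum
  simp only [Finset.card_univ, Fintype.card_fin, Nat.cast_ofNat] at hle
  have hterm : ∀ i : Fin 8, ((8 : ℝ) * (K * L * T ^ (α i) * n ^ (β i))) ^ (1 / (3 - a i)) ≤
      max 1 (8 * K) * L * (T ^ (α i / (3 - a i)) * n ^ (β i / (3 - a i))) :=
    fun i ↦ solve_term_le hK0 hL hT hn (ha2 i)
  have hfinal : X ≤ ∑ i : Fin 8, max 1 (8 * K) * L * (T ^ (α i / (3 - a i)) * n ^ (β i / (3 - a i))) :=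
    hle.trans (Finset.sum_le_sum fun i _ ↦ hterm i)
  rw [Fin.sum_univ_eight] at hfinal
  -- Step 4: identify the exponents
  have e0T : α 0 / (3 - a 0) = 0 := by simp [α, a]
  have e0n : β 0 / (3 - a 0) = 2 - 2 * σ := by simp only [β, a, Matrix.cons_val_zero]; ring
  have e1T : α 1 / (3 - a 1) = 0 := by simp [α, a]
  have e1n : β 1 / (3 - a 1) = 5 - 6 * σ := by
    simp only [β, a, Matrix.cons_val_one, Matrix.cons_val_zero]; ring
  have e2T : α 2 / (3 - a 2) = (k : ℝ) / ((k : ℝ) + 1) := by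
    simp only [α, a, Matrix.cons_val]
    rw [show (3 : ℝ) - (2 - 1 / (k : ℝ)) = ((k : ℝ) + 1) / (k : ℝ) by field_simp; ring]
    rw [div_div_eq_mul_div, one_mul]
  have e2n : β 2 / (3 - a 2) = (4 - 6 * σ) * ((k : ℝ) / ((k : ℝ) + 1)) := by
    simp only [β, a, Matrix.cons_val]
    rw [show (3 : ℝ) - (2 - 1 / (k : ℝ)) = ((k : ℝ) + 1) / (k : ℝ) by field_simp; ring]
    rw [div_div_eq_mul_div, mul_div_assoc]
  have e3T : α 3 / (3 - a 3) = 2 / (4 * (k : ℝ) + 3) := by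
    simp only [α, a, Matrix.cons_val]
    rw [show (3 : ℝ) - (2 - 3 / (4 * (k : ℝ))) = (4 * (k : ℝ) + 3) / (4 * (k : ℝ)) by
      field_simp; ring]
    rw [div_div_eq_mul_div, mul_div_assoc]
    field_simp
    ring
  have e3n : β 3 / (3 - a 3) = (5 - 6 * σ) * (4 * (k : ℝ) / (4 * (k : ℝ) + 3)) := by
    simp only [β, a, Matrix.cons_val]
    rw [show (3 : ℝ) - (2 - 3 / (4 * (k : ℝ))) = (4 * (k : ℝ) + 3) / (4 * (k : ℝ)) by
      field_simp; ring]
    rw [div_div_eq_mul_div, mul_div_assoc]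
  have e4T : α 4 / (3 - a 4) = 4 / 3 := by simp only [α, a, Matrix.cons_val]; norm_num
  have e4n : β 4 / (3 - a 4) = 2 - 4 * σ := by simp only [β, a, Matrix.cons_val]; ring
  have e5T : α 5 / (3 - a 5) = 1 / 2 := by simp only [α, a, Matrix.cons_val]; norm_num
  have e5n : β 5 / (3 - a 5) = 3 - 4 * σ := by simp only [β, a, Matrix.cons_val]; ring
  have e6T : α 6 / (3 - a 6) = 1 := by simp only [α, a, Matrix.cons_val]; norm_num
  have e6n : β 6 / (3 - a 6) = 9 / 2 - 7 * σ := by simp only [β, a, Matrix.cons_val]; ring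
  have e7T : α 7 / (3 - a 7) = 18 / 19 := by simp only [α, a, Matrix.cons_val]; norm_num
  have e7n : β 7 / (3 - a 7) = (72 - 112 * σ) / 19 := by simp only [β, a, Matrix.cons_val]; ring
  rw [e0T, e0n, e1T, e1n, e2T, e2n, e3T, e3n, e4T, e4n, e5T, e5n, e6T, e6n, e7T, e7n, hT0',
    Real.rpow_one, one_mul, one_mul] at hfinal
  have hM0 : 0 ≤ max 1 (8 * K) * L := by positivity
  nlinarith [hfinal, hM0]

/-- The third `S₂` term of Proposition 6.1 as printed versus its monomial form:
`X²(T^{1/2}/X^{3/4})^{1/k} = T^{1/(2k)} X^{2−3/(4k)}` for `X > 0`, `T ≥ 0`.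
[cite: GuthMaynard2026, Proposition 6.1 (statement)] -/
theorem sq_mul_div_rpow_eq {X T : ℝ} (k : ℕ) (hX : 0 < X) (hT : 0 ≤ T) :
    X ^ 2 * (T ^ (1 / 2 : ℝ) / X ^ (3 / 4 : ℝ)) ^ (1 / (k : ℝ)) =
      T ^ (1 / (2 * (k : ℝ))) * X ^ (2 - 3 / (4 * (k : ℝ))) := by
  rw [Real.div_rpow (by positivity) (by positivity), ← Real.rpow_mul hT, ← Real.rpow_mul hX.le,
    Real.rpow_sub hX, Real.rpow_two]
  have hX34 : 0 < X ^ (3 / 4 * (1 / (k : ℝ))) := Real.rpow_pos_of_pos hX _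
  rw [show (1 / 2 : ℝ) * (1 / (k : ℝ)) = 1 / (2 * (k : ℝ)) by ring,
    show (3 : ℝ) / (4 * (k : ℝ)) = 3 / 4 * (1 / (k : ℝ)) by ring]
  field_simp

set_option maxHeartbeats 800000 in
/-- **Eq. (12.1) with `T` and `k` free, the `S₂` terms exactly as printed in Proposition 6.1**
(`N²|W|² + TN|W|^{2−1/k} + N²|W|²(T^{1/2}/|W|^{3/4})^{1/k}`), for `X = |W| ≥ 1`.
[cite: GuthMaynard2026, Section 12, proof of Proposition 3.1, eq. (12.1)] -/
theorem fullBound_of_bounds_literal (C₀ C₁ : ℝ) (hC₀ : 0 ≤ C₀) (hC₁ : 0 ≤ C₁) :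
    ∃ C, 0 ≤ C ∧ ∀ (k : ℕ) (σ n T L X S : ℝ), 1 ≤ k → 1 ≤ n → 1 ≤ T → 1 ≤ L → 1 ≤ X → 0 ≤ S →
      X ≤ C₀ * (n ^ (2 - 2 * σ) + n ^ (1 - 2 * σ) * S ^ (1 / 3 : ℝ)) →
      S ≤ C₁ * L * (n ^ 2 * X ^ 2 + T * n * X ^ (2 - 1 / (k : ℝ)) +
        n ^ 2 * X ^ 2 * (T ^ (1 / 2 : ℝ) / X ^ (3 / 4 : ℝ)) ^ (1 / (k : ℝ)) +
        T ^ 2 * X ^ (3 / 2 : ℝ) + T * X * n ^ (3 - 2 * σ) + T * X ^ 2 * n ^ (3 / 2 - σ) +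
        T ^ (9 / 8 : ℝ) * X ^ (29 / 16 : ℝ) * n ^ (3 / 2 - σ)) →
      X ≤ C * L * (n ^ (2 - 2 * σ) + n ^ (5 - 6 * σ) +
        T ^ ((k : ℝ) / ((k : ℝ) + 1)) * n ^ ((4 - 6 * σ) * ((k : ℝ) / ((k : ℝ) + 1))) +
        n ^ ((5 - 6 * σ) * (4 * (k : ℝ) / (4 * (k : ℝ) + 3))) * T ^ (2 / (4 * (k : ℝ) + 3)) +
        T ^ (4 / 3 : ℝ) * n ^ (2 - 4 * σ) + T ^ (1 / 2 : ℝ) * n ^ (3 - 4 * σ) +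
        T * n ^ (9 / 2 - 7 * σ) + T ^ (18 / 19 : ℝ) * n ^ ((72 - 112 * σ) / 19)) := by
  obtain ⟨C, hC0, hC⟩ := fullBound_of_bounds C₀ C₁ hC₀ hC₁
  refine ⟨C, hC0, ?_⟩
  intro k σ n T L X S hk hn hT hL hX hS0 h0 hS
  refine hC k σ n T L X S hk hn hT hL (by linarith) hS0 h0 ?_
  have e : n ^ 2 * X ^ 2 * (T ^ (1 / 2 : ℝ) / X ^ (3 / 4 : ℝ)) ^ (1 / (k : ℝ)) =
      n ^ 2 * T ^ (1 / (2 * (k : ℝ))) * X ^ (2 - 3 / (4 * (k : ℝ))) := by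
    rw [mul_assoc, sq_mul_div_rpow_eq k (by linarith) (by linarith)]; ring
  rw [e] at hS
  exact hS

end GuthMaynardAssemblyFreeT

end Literature.NumberTheory.LFunctions
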